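import Summits.ResolutionOfSingularities.ResolutionOfSingularities.Theorems.PurelyInseparableDim4ScopeBlindNormLeaf
import Summits.ResolutionOfSingularities.ResolutionOfSingularities.Theorems.PurelyInseparableDim4ScopeBlindSubstDomain
import HarnessLib

/-!
# UNIFORM-OUT ON A PARAMETRISED LOCUS: `substBlindB` certifies EVERY point of the IMAGE of `σ` — cell «res-dim4-pi», ∀K column ‖ K

Seat res-dim4-p-8 g3, for res-dim4-typ-3g9's FCert v2 and res-dim4-eng-w2 g2's class (3) (bus 2026-08-29 01:00Z: 6 rows / 3 components
with a polynomial PARAMETRISATION but no retraction — the cusp cylinders `x₄³ + x₂²`, `x₄³ + x₃²` with `ψ = (t, s³, 0, s²)`, and the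
Frobenius type `x₂² + x₃³ + x₄³` with `ψ = (0, s³ + t³, s², t²)`).  Observation: this seat's FILE 2 (`…ScopeBlindSubstCert`,
`not_inCoordinateScope_step_map_of_substBlindB`) asked the point `b` to be FIXED by `σ`; the domain lemma (`…ScopeBlindSubstDomain`,
`A := K[x]`, `ev := eval u`) shows the same certificate certifies every point `b = σ(u)` of the IMAGE of `σ` — a retraction is the
special case `u = b`.  So polynomial parametrisations need NO new checker:

* §1 `not_inCoordinateScope_step_of_algClosure` — DESCENT: blindness of the child over `AlgebraicClosure K` at the image point gives
  blindness over `K` (res-dim4-p-14's `BaseChange.step_map` + `ScopeDescent.inCoordinateScope_map_iff`);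
* §2 **`not_inCoordinateScope_step_map_of_substBlindB_image`**: `substBlindB p (chartL p S j s.L) σ T α₀ = true` ⟹ for every field `K`
  of characteristic `p`, every `f : k →+* K` and EVERY parameter `u ∈ K⁴`, the child of `s ⊗ K` at `b = (σ ⊗ K)(u)` is OUT of coordinate
  scope; **`…_image_algClosure`**: the same when the parameter `u` is only found over `AlgebraicClosure K` (inseparable
  parametrisations: `s² = b₃` need not be solvable in `K`) — by §1;
* §3 acceptance on eng-w2's row S1a-2c8103b8a1 (`x₄³ + x₃³x₄ + x₂²x₃`, point centre, chart `x₃`; locus `{x₃ = 0, x₄³ = x₂²}`, the cusp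
  cylinder): `substBlindB_cuspSpec` by `decide` with `σ = (x₁, x₂³, 0, x₂²)` and **`cuspSpec_children_blind`**: ∀ K ∀ b with `b₃ = 0`,
  `b₄³ = b₂²` the child is out of coordinate scope (parameter `s = b₂/b₄`, resp. `0`).

Honest scope: sufficient criteria for ONE child of OUR frame to be out of coordinate scope; nothing here proves F4-C(2,2) or resolution of
singularities in dim ≥ 4 / char p.  [OURS · counted 0 · kernel work, weaker than expert review.]
bears_on: LADDER-RESOLUTION:D157-DOOR2 (res-dim4-pi · ∀K column · parametrised leaf).  Supports stmt-ResolutionOfSingularities-16155 (helper).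
-/

set_option linter.dupNamespace false -- mandated namespace of this single-conjunct summit

noncomputable section

open MvPolynomial Finset
open scoped BigOperators

namespace Summit.ResolutionOfSingularities.ResolutionOfSingularities.Theorems.PIDim4

namespace ScopeBlind

open Literature.AlgebraicGeometry.Resolution
open Literature.AlgebraicGeometry.Resolution.CentreBlowup
open Literature.AlgebraicGeometry.Resolution.Hauser2010
open StepKit ScopeCover ScopeDynamics

/-! ## §1 Descent from the algebraic closure -/

open scoped Classical in
/-- **DESCENT.**  If the child of `F ⊗ K̄` at the image point `ι ∘ b` is out of coordinate scope (`K̄ = AlgebraicClosure K`), so is the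
child of `F` at `b`. [folklore] -/
theorem not_inCoordinateScope_step_of_algClosure {p : ℕ} {K : Type} [Field K] [DecidableEq K] (S : Finset (Fin 4)) (j : Fin 4)
    (F : MvPolynomial (Fin 4) K) (r : Fin 4 →₀ ℕ) (exc : Finset (Fin 4)) (b : Fin 4 → K)
    (h : ¬ InCoordinateScope p
      (CentreBlowup.step p S j (⇑(algebraMap K (AlgebraicClosure K)) ∘ b)
        (⟨MvPolynomial.map (algebraMap K (AlgebraicClosure K)) F, r, exc⟩ : State (AlgebraicClosure K))).F) :
    ¬ InCoordinateScope p (CentreBlowup.step p S j b (⟨F, r, exc⟩ : State K)).F := by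
  intro hsc
  apply h
  rw [BaseChange.step_map (algebraMap K (AlgebraicClosure K)) p S j b (⟨F, r, exc⟩ : State K)]
  exact (ScopeDescent.inCoordinateScope_map_iff (algebraMap K (AlgebraicClosure K))).2 hsc

/-! ## §2 `substBlindB` certifies every point of the image of `σ` -/

variable {k : Type} [Field k] [DecidableEq k]

/-- **IMAGE SOUNDNESS.**  If `substBlindB p (chartL p S j s.L) σ T α₀ = true`, then for every field `K` of characteristic `p`, every
`f : k →+* K` and every parameter `u : Fin 4 → K`, the child of `s ⊗ K` at the image point `b i := eval u ((σ i) ⊗ K)` is OUT of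
coordinate scope.  (FILE 2's fixed-point form is the case `u = b`.) OURS. [folklore] -/
theorem not_inCoordinateScope_step_map_of_substBlindB_image {p : ℕ} [Fact p.Prime] {s : SData 4 k} {S : Finset (Fin 4)}
    {j : Fin 4} {σ : Fin 4 → Terms 4 k} {T : Finset (Fin 4)} {α₀ : Fin 4 → ℕ}
    (h : substBlindB p (chartL p S j s.L) σ T α₀ = true)
    (K : Type) [Field K] [CharP K p] [DecidableEq K] (f : k →+* K) (u : Fin 4 → K) :
    ¬ InCoordinateScope p
      (CentreBlowup.step p S j (fun i => MvPolynomial.eval u (MvPolynomial.map f (evalT (σ i))))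
        (⟨MvPolynomial.map f s.toState.F, s.toState.r, s.toState.exc⟩ : State K)).F := by
  classical
  simp only [substBlindB, Bool.and_eq_true, decide_eq_true_eq, List.all_eq_true, Bool.not_eq_true'] at h
  obtain ⟨⟨⟨⟨hT, hnc⟩, hJ⟩, hα₀⟩, hW⟩ := h
  have hdeg : (expo α₀).degree = ∑ i, α₀ i := degree_expo α₀
  have hG : chartTransform p S j (MvPolynomial.map f s.toState.F) = MvPolynomial.map f (evalT (chartL p S j s.L)) := by
    rw [SData.toState_F, WinCertAllFields.chartTransform_map, chartTransform_evalT]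
  refine not_inCoordinateScope_step_of_substHom p S j _
    (MvPolynomial.aeval fun i => MvPolynomial.map f (evalT (σ i))).toRingHom T (fun i hi => ?_) (fun i hi c => ?_)
    (fun α h0 hq => ?_) (expo α₀) (by rw [hdeg]; exact hα₀.1) (by rw [hdeg]; exact hα₀.2) ?_ (MvPolynomial.eval u) _
    (fun c => by simp) (fun i => by simp)
  · simp [(evalT_eq_zero_iff _).mpr (hT i hi)]
  · obtain ⟨e, he, hne⟩ := hnc i hi
    simpa using map_evalT_ne_C f he hne c
  · change MvPolynomial.aeval (fun i => MvPolynomial.map f (evalT (σ i)))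
      (hasseDeriv α (chartTransform p S j (MvPolynomial.map f s.toState.F))) = 0
    rw [hG, IsolationConverse.hasseDeriv_map, aeval_map_comm, ← expo_coe α, hasseDeriv_evalT, aeval_evalT_substL4,
      (evalT_eq_zero_iff _).mpr (hJ (⇑α) (mem_idxLT h0 hq)), map_zero]
  · change MvPolynomial.aeval (R := K) (fun i : Fin 4 => if i ∈ T then (0 : MvPolynomial (Fin 4) K) else X i)
      (hasseDeriv (expo α₀) (chartTransform p S j (MvPolynomial.map f s.toState.F))) ≠ 0
    rw [hG, IsolationConverse.hasseDeriv_map, aeval_killT_map, hasseDeriv_evalT, aeval_killT_evalT]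
    intro h0
    apply (not_congr (evalT_eq_zero_iff _)).mpr (by rw [hW]; exact Bool.false_ne_true)
    exact (map_eq_zero_iff _ (MvPolynomial.map_injective f f.injective)).mp h0

/-- **IMAGE SOUNDNESS WITH PARAMETERS IN `K̄`** (inseparable parametrisations): if `b ∈ K⁴` becomes an image point of `σ` over
`AlgebraicClosure K`, the child at `b` is OUT of coordinate scope. OURS. [folklore] -/
theorem not_inCoordinateScope_step_map_of_substBlindB_image_algClosure {p : ℕ} [Fact p.Prime] {s : SData 4 k}
    {S : Finset (Fin 4)} {j : Fin 4} {σ : Fin 4 → Terms 4 k} {T : Finset (Fin 4)} {α₀ : Fin 4 → ℕ}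
    (h : substBlindB p (chartL p S j s.L) σ T α₀ = true)
    (K : Type) [Field K] [CharP K p] [DecidableEq K] (f : k →+* K) (b : Fin 4 → K)
    (hu : ∃ u : Fin 4 → AlgebraicClosure K, ∀ i : Fin 4,
      MvPolynomial.eval u (MvPolynomial.map ((algebraMap K (AlgebraicClosure K)).comp f) (evalT (σ i))) =
        algebraMap K (AlgebraicClosure K) (b i)) :
    ¬ InCoordinateScope p
      (CentreBlowup.step p S j b (⟨MvPolynomial.map f s.toState.F, s.toState.r, s.toState.exc⟩ : State K)).F := by
  classical
  obtain ⟨u, hu⟩ := hu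
  refine not_inCoordinateScope_step_of_algClosure S j _ _ _ b ?_
  have hb : (⇑(algebraMap K (AlgebraicClosure K)) ∘ b) = fun i =>
      MvPolynomial.eval u (MvPolynomial.map ((algebraMap K (AlgebraicClosure K)).comp f) (evalT (σ i))) :=
    funext fun i => (hu i).symm
  rw [hb, MvPolynomial.map_map]
  exact not_inCoordinateScope_step_map_of_substBlindB_image h (AlgebraicClosure K) ((algebraMap K (AlgebraicClosure K)).comp f) u

/-- the `ZMod p` entry (image points with parameters in `K`). OURS. [folklore] -/
theorem not_inCoordinateScope_step_cast_of_substBlindB_image {p : ℕ} [Fact p.Prime] {s : SData 4 (ZMod p)} {S : Finset (Fin 4)}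
    {j : Fin 4} {σ : Fin 4 → Terms 4 (ZMod p)} {T : Finset (Fin 4)} {α₀ : Fin 4 → ℕ}
    (h : substBlindB p (chartL p S j s.L) σ T α₀ = true)
    (K : Type) [Field K] [CharP K p] [DecidableEq K] (u : Fin 4 → K) (b : Fin 4 → K)
    (hb : ∀ i : Fin 4, MvPolynomial.eval u (MvPolynomial.map (ZMod.castHom (dvd_refl p) K) (evalT (σ i))) = b i) :
    ¬ InCoordinateScope p
      (CentreBlowup.step p S j b
        (⟨MvPolynomial.map (ZMod.castHom (dvd_refl p) K) s.toState.F, s.toState.r, s.toState.exc⟩ : State K)).F := by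
  rw [show b = fun i => MvPolynomial.eval u (MvPolynomial.map (ZMod.castHom (dvd_refl p) K) (evalT (σ i))) from
    funext fun i => (hb i).symm]
  exact not_inCoordinateScope_step_map_of_substBlindB_image h K (ZMod.castHom (dvd_refl p) K) u

/-! ## §3 Acceptance: the cusp cylinder of eng-w2's row S1a-2c8103b8a1 -/

/-- the root `x₄³ + x₃³x₄ + x₂²x₃` over `𝔽₂` (`r = 0`, `exc = ∅`); its `x₃`-chart child under the point blow-up is
`x₃ (x₄³ + x₃x₄ + x₂²)`, whose 2-fold locus on `E = {x₃ = 0}` is the cusp cylinder `{x₃ = 0, x₄³ = x₂²}`. [OURS · specimen] -/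
def cuspSpec : SData 4 (ZMod 2) := ⟨[(![0, 0, 0, 3], 1), (![0, 0, 3, 1], 1), (![0, 2, 1, 0], 1)], ![0, 0, 0, 0], ∅⟩

/-- the parametrisation `ψ = (x₁, x₂³, 0, x₂²)` (parameters `t = x₁`, `s = x₂`) as a substitution certificate (`T = {x₃}`, `α₀ = e₃`),
by `decide`. [OURS · ‖ K] -/
theorem substBlindB_cuspSpec :
    substBlindB 2 (chartL 2 Finset.univ 2 cuspSpec.L)
      ![[(![1, 0, 0, 0], 1)], [(![0, 3, 0, 0], 1)], [], [(![0, 2, 0, 0], 1)]] {2} ![0, 0, 1, 0] = true := by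
  decide

/-- **hence over EVERY field `K` of characteristic `2`, at EVERY point `b` with `b₃ = 0` and `b₄³ = b₂²`, the child of
`x₄³ + x₃³x₄ + x₂²x₃` (point blow-up, chart `x₃`) is OUT of coordinate scope** (parameter `s = b₂/b₄` if `b₄ ≠ 0`, else `s = 0`).
[OURS · ‖ K] -/
theorem cuspSpec_children_blind (K : Type) [Field K] [CharP K 2] [DecidableEq K] (b : Fin 4 → K) (hb3 : b 2 = 0)
    (hZ : b 3 ^ 3 = b 1 ^ 2) :
    ¬ InCoordinateScope 2
      (CentreBlowup.step 2 Finset.univ 2 b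
        (⟨MvPolynomial.map (ZMod.castHom (dvd_refl 2) K) cuspSpec.toState.F, cuspSpec.toState.r, cuspSpec.toState.exc⟩ :
          State K)).F := by
  by_cases h4 : b 3 = 0
  · have h1 : b 1 = 0 := by
      have : b 1 ^ 2 = 0 := by rw [← hZ, h4]; ring
      exact pow_eq_zero_iff (n := 2) (by norm_num) |>.mp this
    refine not_inCoordinateScope_step_cast_of_substBlindB_image substBlindB_cuspSpec K ![b 0, 0, 0, 0] b fun i => ?_
    fin_cases i <;> simp [monomial_expo_eq, Fin.prod_univ_four, hb3, h1, h4]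
  · have h1 : b 1 ≠ 0 := by
      intro h1
      apply h4
      have : b 3 ^ 3 = 0 := by rw [hZ, h1]; ring
      exact pow_eq_zero_iff (n := 3) (by norm_num) |>.mp this
    have hs3 : (b 1 / b 3) ^ 3 = b 1 := by
      rw [div_pow, hZ]
      field_simp
    have hs2 : (b 1 / b 3) ^ 2 = b 3 := by
      rw [div_pow, ← hZ]
      field_simp
    refine not_inCoordinateScope_step_cast_of_substBlindB_image substBlindB_cuspSpec K ![b 0, b 1 / b 3, 0, 0] b fun i => ?_
    fin_cases i <;> simp [monomial_expo_eq, Fin.prod_univ_four, hb3, hs3, hs2]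

end ScopeBlind

end Summit.ResolutionOfSingularities.ResolutionOfSingularities.Theorems.PIDim4

end
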